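import Summits.QuantumFields.QCD.Theorems.PauliWegnerSeaChiralGluonicCompletionPinShapeModel

/-!
# Crux `ChiralGluonicCompletion` (stmt-QuantumFields-17498), line `Sketch` — the chirality stub E* against
# THRESHOLD models of the pin: monotone, continuous, per-tuple-gapped gap curves still do not give E*;
# convergence of the gap at each fixed tuple does (lead cycle 6, dead-line calibration, 2026-08-17)

Companion to `PauliWegnerSeaChiralGluonicCompletionPinShapeModel.lean` (p142184).  There the violation predicate of the
countermodel was an arbitrary antitone-in-the-rate predicate; the natural objection is that honest gap violations have much
more structure: at cutoff `k` the positive tuple `m` violates the `ε`-gap bound iff `g k m < ε` for a GAP CURVE `g k : ℝ → ℝ`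
that is monotone in the mass (lighter quarks, lighter pion) and continuous, and — what stub C1 of the line would add —
every fixed positive tuple is uniformly gapped across ALL cutoffs (`∀ m > 0, ∃ r > 0, ∀ k, r ≤ g k m`).
`pinThreshold_not_entails_hereditaryPin` shows that all of this together with the pin's shape
`∀ ε > 0, ∃ m > 0, ∃ᶠ k, g k m < ε` still does not entail the hereditary pin E* along any subsequence.  Model: cutoffs in
infinitely many infinite blocks `i(k) = (Nat.unpair k).1`, gap curve `g k m = max (1/(i+1)) ((i+1) m)` — block `i` has
"chiral offset" `1/(i+1) → 0` but "mass slope" `i+1 → ∞`.  Every rate is violated infinitely often (block `i`, tuple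
`1/(i+1)²`), every fixed tuple `m` is gapped at rate `m` at every cutoff, yet a subsequence meeting a block `i₀` infinitely
often is never light below `1/(i₀+1)`, and one leaving every block has every fixed tuple eventually heavy at rate `1`.
What fails in the model is exactly CONVERGENCE of the gap curve at fixed tuples across cutoffs (the slopes run away — an
effective mass-renormalisation mismatch that `HasMassScaling` constrains only for the declared `Z_m`, not for the
correlators).  `eventualShape_of_pinThreshold_of_tendsto` is the positive counterpart: if `g k m → glim m` for every positive
tuple (the lattice gap at fixed renormalised masses has a limit as `k → ∞` — continuum-limit regularity of the GIVEN
regularisation in full-sequence form), the pin's shape upgrades to the EVENTUAL shape, which is hereditary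
(`hereditaryShape_of_pinThreshold_of_tendsto`, via the landed `eventualShape_hereditary`).  Reading for the planners (no
statement about lattice QCD is made here): the input E* needs and `Hyp` lacks is cutoff-to-cutoff regularity of the given
trajectory, i.e. continuum-limit content, or the eventual / Goldstone form of the pin in the hypothesis (VERDICT-c5).
-/

namespace Summit.QuantumFields.QCD.Theorems.StronglyChiralSubsequence

open Filter Topology

/-- The block model's gap curve, axiomatised by its defining equation (kept as a hypothesis `hg` so that no definition
is introduced): monotone in the mass. -/
theorem pinThresholdModel_monotone (g : ℕ → ℝ → ℝ)
    (hg : ∀ k m, g k m = max (1 / (((Nat.unpair k).1 : ℝ) + 1)) ((((Nat.unpair k).1 : ℝ) + 1) * m)) (k : ℕ) :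
    Monotone (g k) := fun a b hab => by
  rw [hg, hg]
  exact max_le_max le_rfl (mul_le_mul_of_nonneg_left hab (by positivity))

/-- The block model's gap curve is continuous in the mass at every cutoff. -/
theorem pinThresholdModel_continuous (g : ℕ → ℝ → ℝ)
    (hg : ∀ k m, g k m = max (1 / (((Nat.unpair k).1 : ℝ) + 1)) ((((Nat.unpair k).1 : ℝ) + 1) * m)) (k : ℕ) :
    Continuous (g k) := by
  have : g k = fun m => max (1 / (((Nat.unpair k).1 : ℝ) + 1)) ((((Nat.unpair k).1 : ℝ) + 1) * m) := funext (hg k)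
  rw [this]
  exact continuous_const.max (continuous_const.mul continuous_id)

/-- The block model has the pin's shape: rate `ε` is violated at the tuple `1/(i+1)²`, `1/(i+1) < ε`, at every cutoff of
block `i` (where the gap curve takes the value `1/(i+1)`). -/
theorem pinThresholdModel_pinShape (g : ℕ → ℝ → ℝ)
    (hg : ∀ k m, g k m = max (1 / (((Nat.unpair k).1 : ℝ) + 1)) ((((Nat.unpair k).1 : ℝ) + 1) * m)) :
    ∀ ε > (0 : ℝ), ∃ m : ℝ, 0 < m ∧ ∃ᶠ k in atTop, g k m < ε := by
  intro ε hε
  obtain ⟨i, hi⟩ := exists_nat_one_div_lt hε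
  refine ⟨1 / (((i : ℝ) + 1) ^ 2), by positivity, ?_⟩
  have hfreq : ∃ᶠ k in atTop, (Nat.unpair k).1 = i :=
    frequently_atTop.2 fun a => ⟨Nat.pair i a, Nat.right_le_pair i a, by simp [Nat.unpair_pair]⟩
  refine hfreq.mono fun k hk => ?_
  have hval : (((i : ℝ) + 1)) * (1 / (((i : ℝ) + 1) ^ 2)) = 1 / ((i : ℝ) + 1) := by
    field_simp
  rw [hg, hk, hval, max_self]
  exact hi

/-- In the block model every fixed positive tuple `m` is uniformly gapped at rate `m` across ALL cutoffs
(`m ≤ (i+1) m ≤ g k m`) — the C1-shape of line `Sketch` holds in the model. -/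
theorem pinThresholdModel_tupleGap (g : ℕ → ℝ → ℝ)
    (hg : ∀ k m, g k m = max (1 / (((Nat.unpair k).1 : ℝ) + 1)) ((((Nat.unpair k).1 : ℝ) + 1) * m)) :
    ∀ m > (0 : ℝ), ∃ r : ℝ, 0 < r ∧ ∀ k, r ≤ g k m := by
  intro m hm
  refine ⟨m, hm, fun k => ?_⟩
  rw [hg]
  exact le_max_of_le_right (le_mul_of_one_le_left hm.le (by linarith [(Nat.cast_nonneg (Nat.unpair k).1 : (0 : ℝ) ≤ _)]))

/-- The block model is hereditarily pinned along NO subsequence: every strictly increasing `φ` has a strictly increasing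
`ψ` and a rate `ε > 0` at which every positive tuple is eventually NOT violated along `φ ∘ ψ`. -/
theorem pinThresholdModel_not_hereditary (g : ℕ → ℝ → ℝ)
    (hg : ∀ k m, g k m = max (1 / (((Nat.unpair k).1 : ℝ) + 1)) ((((Nat.unpair k).1 : ℝ) + 1) * m))
    (φ : ℕ → ℕ) (_hφ : StrictMono φ) :
    ∃ ψ : ℕ → ℕ, StrictMono ψ ∧ ∃ ε > (0 : ℝ), ∀ m : ℝ, 0 < m → ∀ᶠ k in atTop, ¬ g (φ (ψ k)) m < ε := by
  by_cases h : ∃ i₀ : ℕ, ∃ᶠ k in atTop, (Nat.unpair (φ k)).1 = i₀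
  · -- some block `i₀` is met infinitely often: extract it; nothing there is lighter than `1/(i₀+1)`
    obtain ⟨i₀, hi₀⟩ := h
    obtain ⟨ψ, hψ, hψi⟩ := extraction_of_frequently_atTop hi₀
    refine ⟨ψ, hψ, 1 / ((i₀ : ℝ) + 1), Nat.one_div_pos_of_nat, fun m _ => Eventually.of_forall fun k => ?_⟩
    rw [hg, hψi k, not_lt]
    exact le_max_left _ _
  · -- every block is left eventually: every fixed positive tuple is eventually heavy at rate `1`
    simp only [not_exists, not_frequently] at h
    refine ⟨id, strictMono_id, 1, one_pos, fun m hm => ?_⟩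
    obtain ⟨N, hN⟩ := exists_nat_ge (1 / m)
    have hall : ∀ᶠ k in atTop, ∀ i ∈ Finset.range N, ¬ (Nat.unpair (φ k)).1 = i :=
      (eventually_all_finset (Finset.range N)).2 fun i _ => h i
    refine hall.mono fun k hk => ?_
    have hkN : N ≤ (Nat.unpair (φ k)).1 := by
      by_contra hlt
      exact hk _ (Finset.mem_range.2 (not_le.1 hlt)) rfl
    have hNm : (1 : ℝ) ≤ (N : ℝ) * m := by rwa [div_le_iff₀ hm] at hN
    have hmono : (N : ℝ) * m ≤ (((Nat.unpair (φ (id k))).1 : ℝ) + 1) * m := by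
      refine mul_le_mul_of_nonneg_right ?_ hm.le
      have : (N : ℝ) ≤ ((Nat.unpair (φ k)).1 : ℝ) := by exact_mod_cast hkN
      simpa using by linarith
    rw [hg, not_lt]
    exact le_max_of_le_right (hNm.trans hmono)

/-- **Threshold models of the pin do not entail the hereditary pin E*.**  There is a gap curve `g : ℕ → ℝ → ℝ` (cutoff,
mass), MONOTONE and CONTINUOUS in the mass at every cutoff, with the pin's shape `∀ ε > 0, ∃ m > 0, ∃ᶠ k, g k m < ε` AND
every fixed positive tuple uniformly gapped across all cutoffs (`∀ m > 0, ∃ r > 0, ∀ k, r ≤ g k m`, the shape of stub C1),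
such that NO subsequence `φ` is hereditarily pinned (for every `φ` some further `ψ` and some rate `ε > 0` have every positive
tuple failing `∃ᶠ k, g (φ (ψ k)) m < ε`).  Witness: `g k m = max (1/(i+1)) ((i+1) m)`, `i = (Nat.unpair k).1`. -/
theorem pinThreshold_not_entails_hereditaryPin :
    ∃ g : ℕ → ℝ → ℝ,
      (∀ k, Monotone (g k)) ∧ (∀ k, Continuous (g k)) ∧
      (∀ ε > (0 : ℝ), ∃ m : ℝ, 0 < m ∧ ∃ᶠ k in atTop, g k m < ε) ∧
      (∀ m > (0 : ℝ), ∃ r : ℝ, 0 < r ∧ ∀ k, r ≤ g k m) ∧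
      ¬ ∃ φ : ℕ → ℕ, StrictMono φ ∧ ∀ ψ : ℕ → ℕ, StrictMono ψ →
          ∀ ε > (0 : ℝ), ∃ m : ℝ, 0 < m ∧ ∃ᶠ k in atTop, g (φ (ψ k)) m < ε := by
  refine ⟨fun k m => max (1 / (((Nat.unpair k).1 : ℝ) + 1)) ((((Nat.unpair k).1 : ℝ) + 1) * m),
    pinThresholdModel_monotone _ fun _ _ => rfl, pinThresholdModel_continuous _ fun _ _ => rfl,
    pinThresholdModel_pinShape _ fun _ _ => rfl, pinThresholdModel_tupleGap _ fun _ _ => rfl, ?_⟩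
  rintro ⟨φ, hφ, hher⟩
  obtain ⟨ψ, hψ, ε, hε, hnot⟩ := pinThresholdModel_not_hereditary _ (fun _ _ => rfl) φ hφ
  obtain ⟨m, hm, hfreq⟩ := hher ψ hψ ε hε
  obtain ⟨k, hk₁, hk₂⟩ := ((hnot m hm).and_frequently hfreq).exists
  exact hk₁ hk₂

/-- **What does suffice: convergence of the gap curve at each fixed positive tuple.**  If `g k m → glim m` as `k → ∞` for
every `m > 0`, the pin's shape `∀ ε > 0, ∃ m > 0, ∃ᶠ k, g k m < ε` upgrades to the EVENTUAL shape
`∀ ε > 0, ∃ m > 0, ∀ᶠ k, g k m < ε` (the tuple witnessing rate `ε/2` frequently has `glim m ≤ ε/2 < ε`, hence `g k m < ε` for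
all large `k`).  This is the abstract form of "continuum-limit regularity of the given trajectory makes the chirality stub
free". -/
theorem eventualShape_of_pinThreshold_of_tendsto (g : ℕ → ℝ → ℝ) (glim : ℝ → ℝ)
    (hconv : ∀ m > (0 : ℝ), Tendsto (fun k => g k m) atTop (𝓝 (glim m)))
    (hpin : ∀ ε > (0 : ℝ), ∃ m : ℝ, 0 < m ∧ ∃ᶠ k in atTop, g k m < ε) :
    ∀ ε > (0 : ℝ), ∃ m : ℝ, 0 < m ∧ ∀ᶠ k in atTop, g k m < ε := by
  intro ε hε
  obtain ⟨m, hm, hfr⟩ := hpin (ε / 2) (half_pos hε)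
  refine ⟨m, hm, ?_⟩
  have hle : glim m ≤ ε / 2 := by
    by_contra hlt
    rw [not_le] at hlt
    have hev : ∀ᶠ k in atTop, ε / 2 < g k m := (hconv m hm).eventually (lt_mem_nhds hlt)
    obtain ⟨k, hk₁, hk₂⟩ := (hev.and_frequently hfr).exists
    exact lt_irrefl _ (hk₁.trans hk₂)
  exact (hconv m hm).eventually (gt_mem_nhds (by linarith))

/-- … and the eventual shape is hereditary (landed `eventualShape_hereditary`): under convergence of the gap curve at each
fixed positive tuple, EVERY subsequence of every subsequence is pinned — the hereditary pin E* holds along `φ = id`. -/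
theorem hereditaryShape_of_pinThreshold_of_tendsto (g : ℕ → ℝ → ℝ) (glim : ℝ → ℝ)
    (hconv : ∀ m > (0 : ℝ), Tendsto (fun k => g k m) atTop (𝓝 (glim m)))
    (hpin : ∀ ε > (0 : ℝ), ∃ m : ℝ, 0 < m ∧ ∃ᶠ k in atTop, g k m < ε)
    (φ : ℕ → ℕ) (hφ : StrictMono φ) (ψ : ℕ → ℕ) (hψ : StrictMono ψ) :
    ∀ ε > (0 : ℝ), ∃ m : ℝ, 0 < m ∧ ∃ᶠ k in atTop, g (φ (ψ k)) m < ε :=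
  eventualShape_hereditary (fun ε m k => g k m < ε) (eventualShape_of_pinThreshold_of_tendsto g glim hconv hpin) φ hφ ψ hψ

end Summit.QuantumFields.QCD.Theorems.StronglyChiralSubsequence
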